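import Summits.CriticalPhenomena.SAWScalingLimit.Theses.SAWLoopFugacityFlow
import Literature.Probability.RandomPlanarGeometry.ConformalRestrictionProofs
import Literature.Probability.RandomPlanarGeometry.CaratheodoryHalfPlaneProofs
import Literature.Probability.RandomPlanarGeometry.CritPercSLESimplePathHolds
import Literature.Probability.RandomPlanarGeometry.LocalMartingaleProofs
import Literature.Probability.RandomPlanarGeometry.SimpleCurves

/-!
# Negative-side results for the crux `SAWLoopFugacityFlow.SimpleSubseqLimits` (stmt-CriticalPhenomena-4982):
WHY IT RESISTS — the crux is NECESSARY for the summit conjunct (work-file §3).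

`¬ SimpleSubseqLimits → ¬ SAWScalingLimit` and `¬ SimpleSubseqLimits → ¬ SubseqIdentification`,
unconditionally: if the critical SAW converges in law to chordal SLE_(8/3) along an honest endpoint
approximation (Lawler–Schramm–Werner, Prediction 1, as typed in the summit statement), every weak
subsequential limit `ν` of its laws IS that SLE law (weak limits of probability measures are unique,
`ext_of_forall_integral_eq_of_IsFiniteMeasure`), which is carried by simple chords from `a` to `b`
meeting `∂D` only at `a`, `b` (the tree's Rohde–Schramm / Carathéodory theorems `IsSLELaw.ae_simple`,
`IsSLELaw.ae_endpoints`). So a refutation of the crux would refute the summit conjunct itself, and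
the hub-wide hinge `SubseqIdentification` (stmt-CriticalPhenomena-0783) with it.

Refuter `cdisprove` (standing adversary); the full indexed work file is
`Summits/CriticalPhenomena/SAWScalingLimit/Cruxes/SimpleSubseqLimits/Disproof.lean`.
-/

noncomputable section

open MeasureTheory Filter Topology Set
open Literature.Probability.RandomPlanarGeometry Literature.Probability.RandomPlanarGeometry.SAW
open Literature.Probability.LatticeModels
open scoped ENNReal NNReal BoundedContinuousFunction

namespace Summit.CriticalPhenomena.SAWScalingLimit.Theorems.SimpleSubseqLimits.Negative

open Summit.CriticalPhenomena.SAWScalingLimit.Theses.SAWLoopFugacityFlow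
  (SimpleSubseqLimits SubseqIdentification)

/-- **Carrier of SLE_(8/3) laws** (the content of the support item `SLECarrier`, proved inline from
the tree): a chordal SLE_(8/3) law is carried by simple chords from `a` to `b` in `closure D`
meeting `∂D` only at `a`, `b`. [cite: RohdeSchramm2005, Thm. 6.1] -/
theorem ae_carrier_of_isSLELaw {D : DobrushinDomain} {μ : Measure (CurveClass ℂ)}
    (hμ : IsSLELaw ((8 : ℝ≥0) / 3) D μ) :
    ∀ᵐ γ ∂μ, γ ∈ CurveClass.simple ∧ γ.source = D.pt 0 ∧ γ.target = D.pt 1 ∧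
      γ.range ⊆ closure D.carrier ∧ γ.range ∩ frontier D.carrier ⊆ {D.pt 0, D.pt 1} := by
  have h4 : (8 : ℝ≥0) / 3 ≤ 4 := by
    rw [div_le_iff₀ (by norm_num : (0 : ℝ≥0) < 3)]
    norm_num
  filter_upwards [hμ.ae_simple ae_isSimpleTrace_sleTrace_of_le_four_holds
      CurveClass.measurableSet_simple_holds (by positivity) h4,
    hμ.ae_endpoints JordanDomain.mapsTo_boundaryExtension_holds] with γ h1 h2
  exact ⟨h1.1, h2.1, h2.2.1, h2.2.2, h1.2⟩

/-- **A weak subsequential limit coincides with the scaling limit when the latter exists**: under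
convergence in law of the critical SAW to chordal SLE_(8/3) at `(D, a, b)`, every probability
measure `ν` that is the weak limit of the SAW laws along some `s n → 0⁺` is an SLE_(8/3) law.
[folklore] -/
theorem isSLELaw_of_weakLimit {D : DobrushinDomain} {a b : ℝ → Site 2}
    (hconv : ConvergesInLawToSLE ((8 : ℝ≥0) / 3) D
      (fun δ (γ : DomainSAW D.carrier δ (a δ) (b δ)) => γ.curve)
      (fun δ => law D.carrier δ (a δ) (b δ)))
    {s : ℕ → ℝ} {ν : Measure (CurveClass ℂ)} (hs : Tendsto s atTop (𝓝[>] (0 : ℝ)))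
    [IsProbabilityMeasure ν]
    (hw : ∀ f : CurveClass ℂ →ᵇ ℝ,
      Tendsto (fun n => ∫ γ, f γ.curve ∂(law D.carrier (s n) (a (s n)) (b (s n)))) atTop
        (𝓝 (∫ x, f x ∂ν))) :
    IsSLELaw ((8 : ℝ≥0) / 3) D ν := by
  obtain ⟨Γ, hΓ, -, hT⟩ := hconv
  haveI : Fact Literature.Probability.Process.isProjectiveLimit_preWienerMeasure :=
    ⟨isProjectiveLimit_preWienerMeasure_holds⟩
  have hμ : IsSLELaw ((8 : ℝ≥0) / 3) D (Literature.Probability.Process.preWienerMeasure.map Γ) :=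
    ⟨Γ, hΓ, rfl⟩
  haveI := hμ.isProbabilityMeasure
  have key : ∀ f : CurveClass ℂ →ᵇ ℝ,
      ∫ x, f x ∂ν = ∫ x, f x ∂(Literature.Probability.Process.preWienerMeasure.map Γ) := by
    intro f
    have h1 : Tendsto (fun n => ∫ γ, f γ.curve ∂(law D.carrier (s n) (a (s n)) (b (s n))))
        atTop (𝓝 (∫ ω, f (Γ ω) ∂Literature.Probability.Process.preWienerMeasure)) :=
      (hT f).comp hs
    rw [tendsto_nhds_unique (hw f) h1,
      integral_map hΓ.aemeasurable f.continuous.aestronglyMeasurable]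
  rw [ext_of_forall_integral_eq_of_IsFiniteMeasure key]
  exact hμ

/-- **Refuting the crux refutes the summit conjunct**: `¬ SimpleSubseqLimits → ¬ SAWScalingLimit`
(a non-simple, or boundary-touching, subsequential limit of critical SAW along any honest endpoint
approximation contradicts convergence to SLE_(8/3)). The crux is a NECESSARY condition for the
summit. [folklore] -/
theorem not_sawScalingLimit_of_not_simpleSubseqLimits (h : ¬ SimpleSubseqLimits) :
    ¬ _root_.SAWScalingLimit := by
  intro hS
  refine h fun D a b hab s ν hs hν hw => ?_
  exact ae_carrier_of_isSLELaw (isSLELaw_of_weakLimit (hS D a b hab) hs hw)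

/-- **Refuting the crux refutes the identification of subsequential limits**
(`SubseqIdentification`, stmt-CriticalPhenomena-0783): identified limits are SLE_(8/3) laws,
which are carried. [folklore] -/
theorem not_subseqIdentification_of_not_simpleSubseqLimits (h : ¬ SimpleSubseqLimits) :
    ¬ SubseqIdentification := by
  intro hI
  refine h fun D a b hab s ν hs hν hw => ?_
  exact ae_carrier_of_isSLELaw (hI D a b hab s ν hs hν hw)

end Summit.CriticalPhenomena.SAWScalingLimit.Theorems.SimpleSubseqLimits.Negative
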